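import Summits.HodgeConjecture.HodgeConjecture.Theses.MotivatedLefschetzSplit
import Literature.AlgebraicGeometry.HodgeTheory.MotivatedClassesProofs
import HarnessLib

/-!
# Route `MotivatedLefschetzSplit`, support `MotivatedSubAlgebraic` (stmt-HodgeConjecture-17934)

André 1996 §2.1 (remark after Déf. 1) in route vocabulary: if the Lefschetz involution of every
polarised smooth projective complex variety is an algebraic correspondence (standard conjecture
`B`, inlined) and diagonal pull-back preserves algebraic classes (inlined), then
`A_motᵖ(X)_ℂ ⊆ Nᵖ H²ᵖ(X(ℂ); ℂ) = algebraicClasses X p` for every smooth projective `X` and every `p`.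
This is exactly the tree's PROVED reduction
`Literature.AlgebraicGeometry.HodgeTheory.motivatedClasses_le_algebraicClasses_of_standardConjectureB_of_map_diagonal`
(file `MotivatedClassesProofs`), with its two hypotheses taken in the item's order.
-/

set_option linter.dupNamespace false

namespace Summit.HodgeConjecture.HodgeConjecture.Theorems

/-- **Support item `MotivatedSubAlgebraic`** (stmt-HodgeConjecture-17934): `B` for all polarised
smooth projective complex varieties and diagonal pull-back preserving `Nᵖ` imply
`motivatedClasses n X p ≤ algebraicClasses X p` — the tree's
`motivatedClasses_le_algebraicClasses_of_standardConjectureB_of_map_diagonal` (André 1996 §2.1 via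
Voisin II Prop. 9.20–9.22), arguments swapped. [cite: Andre1996Motifs, §2.1 remark following Déf. 1 (p. 14)]
[cite: VoisinHodgeII2003, §9.2.4 proof of Prop. 9.20 and Prop. 9.21 (i)] -/
theorem motivatedLefschetzSplit_motivatedSubAlgebraic_proof :
    Summit.HodgeConjecture.HodgeConjecture.Theses.MotivatedLefschetzSplit.MotivatedSubAlgebraic :=
  fun hB hΔ ↦
    Literature.AlgebraicGeometry.HodgeTheory.motivatedClasses_le_algebraicClasses_of_standardConjectureB_of_map_diagonal
      hΔ hB

end Summit.HodgeConjecture.HodgeConjecture.Theorems
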